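import Literature.Computability.FineGrained.PPSZRecursion
import Mathlib.Data.Nat.Cast.Order.Field
import HarnessLib

/-!
# PPSZ V: the certified forcing probability `q₀ ≥ 0.4322` (`k = 4`, depth `12`, `K = 1024`)

Topic `Literature/Computability/FineGrained`, fifth file of the line `PPSZ*`. PPSZ bound the
integrals `Q_k^{(d)} = ∫₀¹ Q_k^{(d)}(r) dr` through the limit `R_k = μ_k/(k-1)` and the
convergence estimate of Lemma 8 (`μ_4/3 = 0.445…`). The algorithm formalised here uses the fixed
depth `d = 12` and `K = 1024` discrete placement values, and only needs a certified *lower* bound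
for the Riemann sum `(1/K) ∑_{a<K} Q^{(12)}(a/K)` appearing in `Picker.le_prob_cutEvent_root`.
We obtain it by an exact integer computation checked by the kernel:

* `PPSZ.qIter i M P d` — the recursion `x ↦ ⌊(iP + (M-i)x)³ / (M³P²)⌋`, i.e. `f_4(x/P; i/M)`
  in fixed-point arithmetic with precision `1/P`, rounded down, so that
  `qIter i M P d / P ≤ Q^{(d)}(i/M)` (`qIter_div_le_Q`); `PPSZ.qSum` — the partial sums;
* `PPSZ.qSum_val` — `qSum 1024 2^40 12 1024 = 486 700 776 735 534` (by `decide +kernel`);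
* `PPSZ.q0_ge` — hence `(1/1024) ∑_{a<1024} Q^{(12)}(a/1024) ≥ 4322/10000` (the true value is
  `0.43228…`; the limit `μ_4/3` would be `0.44518…`).

## References

* R. Paturi, P. Pudlák, M. E. Saks, F. Zane, J. ACM 52(3) (2005) 337–364, §3.3 (`Q_k^{(d)}`,
  Lemma 8: `Q_k^{(d)} ≥ μ_k/(k−1) − ε_k^{(d)}`; replaced here by a finite computation) and
  Table I (`k = 4`). [key `PaturiPudlakSaksZane2005`]
-/

namespace Literature.Computability.FineGrained.PPSZ

open Finset

/-! ### Fixed-point iteration of `f_4(·; r)` rounded down -/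

/-- The rounded-down fixed-point iteration of `x ↦ (r + (1-r)x)^3`, `r = i/M`, precision `1/P`:
`x_0 = 0`, `x_{j+1} = ⌊(iP + (M-i) x_j)^3 / (M^3 P^2)⌋`. [cite: PaturiPudlakSaksZane2005, §3.3 (Q_k^{(d)}(r); discretised)] -/
def qIter (i M P : ℕ) : ℕ → ℕ
  | 0 => 0
  | j + 1 => (i * P + (M - i) * qIter i M P j) ^ 3 / (M ^ 3 * P ^ 2)

/-- Partial sums `∑_{i<n} qIter i M P d` (numerators of the left Riemann sum). [cite: PaturiPudlakSaksZane2005, §3.3 (Q_k^{(d)} = ∫ Q_k^{(d)}(r) dr; discretised)] -/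
def qSum (M P d : ℕ) : ℕ → ℕ
  | 0 => 0
  | i + 1 => qSum M P d i + qIter i M P d

/-- **The certified computation**: with `M = 1024` grid points, precision `2^{-40}` and depth
`12`, the Riemann-sum numerator is `486 700 776 735 534` (so the sum is `0.43228… · 2^{50}`).
Checked by the kernel (`decide +kernel`, about two seconds). [cite: PaturiPudlakSaksZane2005, Table I (k = 4) and §3.3] -/
theorem qSum_val : qSum 1024 (2 ^ 40) 12 1024 = 486700776735534 := by
  decide +kernel

/-! ### Soundness of the rounding -/

/-- The rounded-down iteration stays below the exact recursion:
`qIter i M P d / P ≤ Q^{(d)}(i/M)`. [cite: PaturiPudlakSaksZane2005, §3.3 (monotonicity of f_k(x; r) in x)] -/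
theorem qIter_div_le_Q {i M P : ℕ} (hi : i ≤ M) (hM : 0 < M) (hP : 0 < P) :
    ∀ d : ℕ, (qIter i M P d : ℝ) / P ≤ Q d (i / M)
  | 0 => by simp [qIter]
  | d + 1 => by
    have hMr : (0 : ℝ) < M := by exact_mod_cast hM
    have hPr : (0 : ℝ) < P := by exact_mod_cast hP
    set r : ℝ := i / M with hr
    have hr0 : 0 ≤ r := by positivity
    have hr1 : r ≤ 1 := by rw [hr, div_le_one hMr]; exact_mod_cast hi
    have ih := qIter_div_le_Q hi hM hP d
    have hq := Q_mem_Icc d hr0 hr1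
    set x : ℝ := (qIter i M P d : ℝ) with hx
    have hx0 : 0 ≤ x := by positivity
    -- the exact value before rounding
    set N : ℝ := i * P + (M - i : ℕ) * x with hN
    have hcast : ((i * P + (M - i) * qIter i M P d : ℕ) : ℝ) = N := by
      rw [hN, hx]; push_cast; ring
    have hstep : (qIter i M P (d + 1) : ℝ) ≤ N ^ 3 / ((M : ℝ) ^ 3 * (P : ℝ) ^ 2) := by
      rw [qIter]
      refine (Nat.cast_div_le).trans (le_of_eq ?_)
      rw [Nat.cast_pow, hcast]
      push_cast
      ring
    -- `N/(MP) = r + (1-r) x/P ≤ r + (1-r) Q^{(d)}(r)`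
    have hNMP : N / (M * P) = r + (1 - r) * (x / P) := by
      rw [hN, hr, Nat.cast_sub hi]
      field_simp
    have hN0 : 0 ≤ N / (M * P) := by rw [hN]; positivity
    have hle : N / (M * P) ≤ r + (1 - r) * Q d r := by
      rw [hNMP]
      have := mul_le_mul_of_nonneg_left ih (sub_nonneg.2 hr1)
      linarith
    calc (qIter i M P (d + 1) : ℝ) / P ≤ N ^ 3 / ((M : ℝ) ^ 3 * (P : ℝ) ^ 2) / P :=
          div_le_div_of_nonneg_right hstep hPr.le
      _ = (N / (M * P)) ^ 3 := by field_simp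
      _ ≤ (r + (1 - r) * Q d r) ^ 3 := pow_le_pow_left₀ hN0 hle 3
      _ = Q (d + 1) r := (Q_succ d r).symm

/-- The Riemann-sum numerator stays below the exact Riemann sum:
`qSum M P d n / P ≤ ∑_{i<n} Q^{(d)}(i/M)` for `n ≤ M`. [cite: PaturiPudlakSaksZane2005, §3.3] -/
theorem qSum_div_le {M P : ℕ} (hM : 0 < M) (hP : 0 < P) (d : ℕ) :
    ∀ {n : ℕ}, n ≤ M → (qSum M P d n : ℝ) / P ≤ ∑ i ∈ range n, Q d (i / M)
  | 0, _ => by simp [qSum]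
  | n + 1, hn => by
    rw [qSum, Nat.cast_add, add_div, sum_range_succ]
    exact add_le_add (qSum_div_le hM hP d (Nat.le_of_succ_le hn))
      (qIter_div_le_Q (Nat.le_of_succ_le hn) hM hP d)

/-- **The certified forcing probability for `k = 4`**: with depth `12` and `K = 1024` placement
values, `(1/1024) ∑_{a<1024} Q^{(12)}(a/1024) ≥ 0.4322`. (PPSZ, Table I / Lemma 8 give the
limit value `μ_4/3 = 0.445…`; `0.4322` is what the finite depth and grid certify, and it suffices
for an exponent `< log₂ (3/2)`.) [cite: PaturiPudlakSaksZane2005, Table I (k = 4), §3.3 Lemma 8] -/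
theorem q0_ge : (4322 / 10000 : ℝ) ≤ (∑ a ∈ range 1024, Q 12 (a / 1024)) / 1024 := by
  have h := qSum_div_le (M := 1024) (P := 2 ^ 40) (by norm_num) (by norm_num) 12 (n := 1024)
    le_rfl
  rw [qSum_val] at h
  rw [le_div_iff₀ (by norm_num : (0 : ℝ) < 1024)]
  refine le_trans ?_ h
  rw [le_div_iff₀ (by positivity)]
  norm_num

end Literature.Computability.FineGrained.PPSZ
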